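import Mathlib
import Literature.Analysis.Convex.LagrangianDuality
import Literature.NumberTheory.LFunctions.WeilExplicit
import Literature.NumberTheory.LFunctions.WeilMellinBounds
import Literature.NumberTheory.LFunctions.WeilWindowSimpleEven
import Summits.RiemannHypothesis.RiemannHypothesis.Theses.SignCone

/-!
# Sketch / COMPLETE CANDIDATE PROOF — crux `SignConeDuality` (stmt-RiemannHypothesis-16304), idea `peel-one-node`

crux-ideate round 1, ideator k = 2 (planner-cruxidea-stmt-RiemannHypothesis-16304-2-0), 2026-08-16.
`lean check` rc 0, **0 sorries**, `#print axioms signConeDuality_closes` = propext, Classical.choice,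
Quot.sound.  A prover can land §Engine–§Candidate verbatim as
`Summits/RiemannHypothesis/RiemannHypothesis/Theorems/SignConeSignConeDuality.lean` (prover-only tree
area; this seat is a planner and only attaches it as evidence / crux workfile).

## The lever: Hahn–Banach-free CONSTRAINT ELIMINATION

The finite cone-Farkas lemma with a Slater point, by induction on the constraint Finset.  Base case
= the two-functional RATIO LEMMA (`cone_multiplier_one`): the multiplier is `inf {L₀ y / L₁ y :
L₁ y > 0}`, and mixing `(L₁ y) • x + (−L₁ x) • y` (which lands on the face `{L₁ = 0}`) shows the
infimum also dominates every `x` with `L₁ x < 0`.  Induction (`cone_multipliers`): restrict to the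
half-cone `K ∩ {L_a ≥ 0}`, peel the other constraints there, then peel `L_a` on `K` with the reduced
objective.  No separation theorem, no topology, no finite-dimensional image; functionals need only
be additive and positively homogeneous ON the cone (which is all the tree proves about `W_ar`).

§ConvexEngine runs the same elimination for convex data and DISCHARGES the vendored named fact
`Literature.Analysis.Convex.BorweinLewis2000_dualAttainment` (Borwein–Lewis 2000 Thm 4.3.7) — in
any real vector space, its `FiniteDimensional` hypothesis unused (`BorweinLewis2000_dualAttainment_holds`;
ready to land as `Literature/Analysis/Convex/LagrangianDualityProofs.lean`).

§Candidate instantiates: `K` = the Weil cone of finite sums of autocorrelations `g ⋆ g̃`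
(`autocorr`, definitionally `weilConv g (weilReflect g)`), closed under `+` (Fin.append) and
`t • ·` (rescale by `√t`); `L₀ F = Re (weilPolarTerm F + weilArchTerm F) + Re F 0` (cone-additive by
the tree's `weilMellin_add` / `weilArchIntegral_add` — the analytic input, used once),
`L n F = Re F (log n)` on the STRICT node set `ι = {n : 2 ≤ n ∧ n < e^{2a}}` (beyond it every
autocorrelation vanishes, `autocorr_eq_zero_of_two_mul_le`); Slater point = one wide `ContDiffBump`
(`slater_bump`); weight `c n = λ n · √n / 2` on `ι`, `0` elsewhere; bookkeeping `autocorr_zero_re`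
(`Re (g⋆g̃)(0) = ∫ ‖g‖²`), `autocorr_neg` (hermitian symmetry), `tsum_eq_sum`.
-/

set_option linter.dupNamespace false

open Set MeasureTheory
open scoped BigOperators ContDiff ComplexConjugate

namespace Summit.RiemannHypothesis.RiemannHypothesis.Cruxes.SignConeDuality.PeelOneNode

open Literature.NumberTheory.LFunctions

section Engine
variable {V : Type*} [AddCommGroup V] [Module ℝ V]

theorem cone_multiplier_one {K : Set V}
    (hKadd : ∀ ⦃x⦄, x ∈ K → ∀ ⦃y⦄, y ∈ K → x + y ∈ K)
    (hKsmul : ∀ ⦃t : ℝ⦄, 0 < t → ∀ ⦃x⦄, x ∈ K → t • x ∈ K)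
    {L₀ L₁ : V → ℝ}
    (h₀add : ∀ ⦃x⦄, x ∈ K → ∀ ⦃y⦄, y ∈ K → L₀ (x + y) = L₀ x + L₀ y)
    (h₀smul : ∀ ⦃t : ℝ⦄, 0 < t → ∀ ⦃x⦄, x ∈ K → L₀ (t • x) = t * L₀ x)
    (h₁add : ∀ ⦃x⦄, x ∈ K → ∀ ⦃y⦄, y ∈ K → L₁ (x + y) = L₁ x + L₁ y)
    (h₁smul : ∀ ⦃t : ℝ⦄, 0 < t → ∀ ⦃x⦄, x ∈ K → L₁ (t • x) = t * L₁ x)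
    (hS : ∃ x₀ ∈ K, 0 < L₁ x₀) (hyp : ∀ x ∈ K, 0 ≤ L₁ x → 0 ≤ L₀ x) :
    ∃ μ : ℝ, 0 ≤ μ ∧ ∀ x ∈ K, μ * L₁ x ≤ L₀ x := by
  classical
  set S : Set ℝ := {r | ∃ y ∈ K, 0 < L₁ y ∧ r = L₀ y / L₁ y} with hSdef
  obtain ⟨x₀, hx₀K, hx₀⟩ := hS
  have hSne : S.Nonempty := ⟨L₀ x₀ / L₁ x₀, x₀, hx₀K, hx₀, rfl⟩
  have hS0 : ∀ r ∈ S, 0 ≤ r := by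
    rintro r ⟨y, hyK, hy, rfl⟩
    exact div_nonneg (hyp y hyK hy.le) hy.le
  have hSbdd : BddBelow S := ⟨0, fun r hr => hS0 r hr⟩
  refine ⟨sInf S, le_csInf hSne hS0, fun x hxK => ?_⟩
  rcases lt_trichotomy 0 (L₁ x) with hpos | hzero | hneg
  · have hle : sInf S ≤ L₀ x / L₁ x := csInf_le hSbdd ⟨x, hxK, hpos, rfl⟩
    calc sInf S * L₁ x ≤ (L₀ x / L₁ x) * L₁ x := mul_le_mul_of_nonneg_right hle hpos.le
      _ = L₀ x := div_mul_cancel₀ _ hpos.ne'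
  · rw [← hzero, mul_zero]
    exact hyp x hxK hzero.le
  · set α : ℝ := -L₁ x with hα
    have hαpos : 0 < α := by simp only [hα]; linarith
    have key : ∀ r ∈ S, -L₀ x / α ≤ r := by
      rintro r ⟨y, hyK, hβ, rfl⟩
      have hxs : (L₁ y) • x ∈ K := hKsmul hβ hxK
      have hys : α • y ∈ K := hKsmul hαpos hyK
      have hz : (L₁ y) • x + α • y ∈ K := hKadd hxs hys
      have hL₁z : L₁ ((L₁ y) • x + α • y) = 0 := by
        rw [h₁add hxs hys, h₁smul hβ hxK, h₁smul hαpos hyK]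
        simp only [hα]
        ring
      have hL₀z : 0 ≤ L₀ ((L₁ y) • x + α • y) := hyp _ hz hL₁z.ge
      rw [h₀add hxs hys, h₀smul hβ hxK, h₀smul hαpos hyK] at hL₀z
      rw [div_le_div_iff₀ hαpos hβ]
      nlinarith
    have hinf : -L₀ x / α ≤ sInf S := le_csInf hSne key
    have hL₁x : L₁ x = -α := by simp [hα]
    rw [hL₁x]
    have h2 := mul_le_mul_of_nonneg_right hinf hαpos.le
    rw [div_mul_cancel₀ _ hαpos.ne'] at h2
    nlinarith

theorem cone_multipliers {ι : Type*} [DecidableEq ι] (s : Finset ι) :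
    ∀ {K : Set V}, (∀ ⦃x⦄, x ∈ K → ∀ ⦃y⦄, y ∈ K → x + y ∈ K) →
      (∀ ⦃t : ℝ⦄, 0 < t → ∀ ⦃x⦄, x ∈ K → t • x ∈ K) →
      ∀ {L₀ : V → ℝ} {L : ι → V → ℝ},
      (∀ ⦃x⦄, x ∈ K → ∀ ⦃y⦄, y ∈ K → L₀ (x + y) = L₀ x + L₀ y) →
      (∀ ⦃t : ℝ⦄, 0 < t → ∀ ⦃x⦄, x ∈ K → L₀ (t • x) = t * L₀ x) →
      (∀ i ∈ s, ∀ ⦃x⦄, x ∈ K → ∀ ⦃y⦄, y ∈ K → L i (x + y) = L i x + L i y) →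
      (∀ i ∈ s, ∀ ⦃t : ℝ⦄, 0 < t → ∀ ⦃x⦄, x ∈ K → L i (t • x) = t * L i x) →
      (∃ x₀ ∈ K, ∀ i ∈ s, 0 < L i x₀) →
      (∀ x ∈ K, (∀ i ∈ s, 0 ≤ L i x) → 0 ≤ L₀ x) →
      ∃ lam : ι → ℝ, (∀ i, 0 ≤ lam i) ∧ ∀ x ∈ K, ∑ i ∈ s, lam i * L i x ≤ L₀ x := by
  induction s using Finset.induction_on with
  | empty =>
    intro K hKadd hKsmul L₀ L h₀add h₀smul hLadd hLsmul hS hyp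
    exact ⟨fun _ => 0, fun _ => le_rfl, fun x hx => by simpa using hyp x hx (by simp)⟩
  | insert a s has ih =>
    intro K hKadd hKsmul L₀ L h₀add h₀smul hLadd hLsmul hS hyp
    have haadd := hLadd a (Finset.mem_insert_self _ _)
    have hasmul := hLsmul a (Finset.mem_insert_self _ _)
    set K' : Set V := {x | x ∈ K ∧ 0 ≤ L a x} with hK'def
    have hK'add : ∀ ⦃x⦄, x ∈ K' → ∀ ⦃y⦄, y ∈ K' → x + y ∈ K' := fun x hx y hy =>
      ⟨hKadd hx.1 hy.1, by rw [haadd hx.1 hy.1]; exact add_nonneg hx.2 hy.2⟩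
    have hK'smul : ∀ ⦃t : ℝ⦄, 0 < t → ∀ ⦃x⦄, x ∈ K' → t • x ∈ K' := fun t ht x hx =>
      ⟨hKsmul ht hx.1, by rw [hasmul ht hx.1]; exact mul_nonneg ht.le hx.2⟩
    obtain ⟨x₀, hx₀K, hx₀⟩ := hS
    have hx₀a : 0 < L a x₀ := hx₀ a (Finset.mem_insert_self _ _)
    obtain ⟨lam, hlam0, hlam⟩ := ih hK'add hK'smul
      (fun x hx y hy => h₀add hx.1 hy.1) (fun t ht x hx => h₀smul ht hx.1)
      (fun i hi x hx y hy => hLadd i (Finset.mem_insert_of_mem hi) hx.1 hy.1)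
      (fun i hi t ht x hx => hLsmul i (Finset.mem_insert_of_mem hi) ht hx.1)
      ⟨x₀, ⟨hx₀K, hx₀a.le⟩, fun i hi => hx₀ i (Finset.mem_insert_of_mem hi)⟩
      (fun x hx h => hyp x hx.1 fun i hi => by
        rcases Finset.mem_insert.mp hi with rfl | hi
        · exact hx.2
        · exact h i hi)
    have h₀'add : ∀ ⦃x⦄, x ∈ K → ∀ ⦃y⦄, y ∈ K →
        (L₀ (x + y) - ∑ i ∈ s, lam i * L i (x + y)) =
          (L₀ x - ∑ i ∈ s, lam i * L i x) + (L₀ y - ∑ i ∈ s, lam i * L i y) := by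
      intro x hx y hy
      rw [h₀add hx hy]
      have : ∑ i ∈ s, lam i * L i (x + y) = ∑ i ∈ s, lam i * L i x + ∑ i ∈ s, lam i * L i y := by
        rw [← Finset.sum_add_distrib]
        exact Finset.sum_congr rfl fun i hi => by
          rw [hLadd i (Finset.mem_insert_of_mem hi) hx hy]; ring
      rw [this]; ring
    have h₀'smul : ∀ ⦃t : ℝ⦄, 0 < t → ∀ ⦃x⦄, x ∈ K →
        (L₀ (t • x) - ∑ i ∈ s, lam i * L i (t • x)) = t * (L₀ x - ∑ i ∈ s, lam i * L i x) := by
      intro t ht x hx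
      rw [h₀smul ht hx]
      have : ∑ i ∈ s, lam i * L i (t • x) = t * ∑ i ∈ s, lam i * L i x := by
        rw [Finset.mul_sum]
        exact Finset.sum_congr rfl fun i hi => by
          rw [hLsmul i (Finset.mem_insert_of_mem hi) ht hx]; ring
      rw [this]; ring
    obtain ⟨μ, hμ0, hμ⟩ := cone_multiplier_one (L₀ := fun x => L₀ x - ∑ i ∈ s, lam i * L i x)
      hKadd hKsmul h₀'add h₀'smul haadd hasmul ⟨x₀, hx₀K, hx₀a⟩
      (fun x hx hax => sub_nonneg.mpr (hlam x ⟨hx, hax⟩))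
    refine ⟨Function.update lam a μ, fun i => ?_, fun x hx => ?_⟩
    · rcases eq_or_ne i a with rfl | hne
      · simp [hμ0]
      · simp [hne, hlam0 i]
    · rw [Finset.sum_insert has]
      have hrest : ∑ i ∈ s, Function.update lam a μ i * L i x = ∑ i ∈ s, lam i * L i x :=
        Finset.sum_congr rfl fun i hi => by
          rw [Function.update_apply, if_neg (ne_of_mem_of_not_mem hi has)]
      rw [hrest, Function.update_apply, if_pos rfl]
      have := hμ x hx
      linarith

end Engine

/-! ## The same elimination for CONVEX data: Borwein–Lewis 4.3.7 without finite dimension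

The mixing trick survives convexity (the inequalities go the right way: `g(z) ≤ θ g x + (1-θ) g y
= 0` makes `z` feasible, `f z ≤ θ f x + (1-θ) f y` transfers the bound), so the vendored named fact
`Literature.Analysis.Convex.BorweinLewis2000_dualAttainment` is DISCHARGED below — in any real
vector space, with no topology and no `FiniteDimensional` hypothesis. -/

section ConvexEngine

variable {E : Type*} [AddCommGroup E] [Module ℝ E]

/-- Ratio lemma, convex form (one constraint). -/
theorem convex_multiplier_one {C : Set E} {f g : E → ℝ} (hf : ConvexOn ℝ C f)
    (hg : ConvexOn ℝ C g) (hS : ∃ x₀ ∈ C, g x₀ < 0) {p : ℝ}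
    (hyp : ∀ x ∈ C, g x ≤ 0 → p ≤ f x) :
    ∃ μ : ℝ, 0 ≤ μ ∧ ∀ x ∈ C, p ≤ f x + μ * g x := by
  classical
  set S : Set ℝ := {r | ∃ y ∈ C, g y < 0 ∧ r = (f y - p) / (-g y)} with hSdef
  obtain ⟨x₀, hx₀C, hx₀⟩ := hS
  have hSne : S.Nonempty := ⟨(f x₀ - p) / (-g x₀), x₀, hx₀C, hx₀, rfl⟩
  have hS0 : ∀ r ∈ S, 0 ≤ r := by
    rintro r ⟨y, hyC, hy, rfl⟩
    exact div_nonneg (sub_nonneg.mpr (hyp y hyC hy.le)) (by linarith)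
  have hSbdd : BddBelow S := ⟨0, fun r hr => hS0 r hr⟩
  refine ⟨sInf S, le_csInf hSne hS0, fun x hxC => ?_⟩
  rcases lt_trichotomy (g x) 0 with hneg | hzero | hpos
  · have hle : sInf S ≤ (f x - p) / (-g x) := csInf_le hSbdd ⟨x, hxC, hneg, rfl⟩
    have hgx : 0 < -g x := by linarith
    have h2 := mul_le_mul_of_nonneg_right hle hgx.le
    rw [div_mul_cancel₀ _ hgx.ne'] at h2
    nlinarith
  · rw [hzero, mul_zero, add_zero]
    exact hyp x hxC hzero.le
  · -- `g x > 0`: mix `x` with a strictly feasible `y` to land on `{g ≤ 0}`.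
    set α : ℝ := g x with hα
    have key : ∀ r ∈ S, (p - f x) / α ≤ r := by
      rintro r ⟨y, hyC, hgy, rfl⟩
      set β : ℝ := -g y with hβ
      have hβpos : 0 < β := by simp only [hβ]; linarith
      have hαβ : 0 < α + β := by linarith
      set θ : ℝ := β / (α + β) with hθ
      have hθ0 : 0 ≤ θ := div_nonneg hβpos.le hαβ.le
      have hθ1 : 0 ≤ 1 - θ := by
        rw [hθ, sub_nonneg, div_le_one hαβ]; linarith
      have hsum : θ + (1 - θ) = 1 := by ring
      have h1θ : 1 - θ = α / (α + β) := by
        rw [hθ]; field_simp; ring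
      have hz : θ • x + (1 - θ) • y ∈ C := hf.1 hxC hyC hθ0 hθ1 hsum
      have hgz : g (θ • x + (1 - θ) • y) ≤ 0 := by
        have := hg.2 hxC hyC hθ0 hθ1 hsum
        simp only [smul_eq_mul] at this
        have hcalc : θ * g x + (1 - θ) * g y = 0 := by
          rw [h1θ, hθ]
          have : g y = -β := by simp [hβ]
          rw [this]
          field_simp
          ring
        linarith
      have hfz := hyp _ hz hgz
      have hfconv := hf.2 hxC hyC hθ0 hθ1 hsum
      simp only [smul_eq_mul] at hfconv
      -- `p ≤ θ f x + (1-θ) f y` with `θ = β/(α+β)`; clear denominators.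
      have hmain : (α + β) * p ≤ β * f x + α * f y := by
        have h3 : p ≤ θ * f x + (1 - θ) * f y := hfz.trans hfconv
        rw [h1θ, hθ] at h3
        have h4 := mul_le_mul_of_nonneg_left h3 hαβ.le
        have h5 : (α + β) * (β / (α + β) * f x + α / (α + β) * f y) = β * f x + α * f y := by
          field_simp
        linarith
      rw [div_le_div_iff₀ hpos hβpos]
      nlinarith
    have hinf : (p - f x) / α ≤ sInf S := le_csInf hSne key
    have h2 := mul_le_mul_of_nonneg_right hinf hpos.le
    rw [div_mul_cancel₀ _ hpos.ne'] at h2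
    nlinarith

/-- Nonnegative combinations of convex functions are convex (Finset form). -/
theorem convexOn_finset_sum_mul {C : Set E} (hC : Convex ℝ C) {ι : Type*} [DecidableEq ι]
    (s : Finset ι) {g : ι → E → ℝ} (hg : ∀ i ∈ s, ConvexOn ℝ C (g i)) (lam : ι → ℝ)
    (hlam : ∀ i, 0 ≤ lam i) : ConvexOn ℝ C (fun x => ∑ i ∈ s, lam i * g i x) := by
  induction s using Finset.induction_on with
  | empty => simpa using convexOn_const (0 : ℝ) hC
  | insert a s has ih =>
    have hga : ConvexOn ℝ C (fun x => lam a * g a x) := by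
      simpa [smul_eq_mul] using (hg a (Finset.mem_insert_self _ _)).smul (hlam a)
    have hs : ConvexOn ℝ C (fun x => ∑ i ∈ s, lam i * g i x) :=
      ih fun i hi => hg i (Finset.mem_insert_of_mem hi)
    have := hga.add hs
    refine this.congr ?_   -- may not exist; fall back below
    intro x hx
    simp [Finset.sum_insert has]

/-- **Borwein–Lewis 4.3.7 (dual attainment under Slater), by constraint elimination**, over an
arbitrary real vector space and an arbitrary finite constraint set. -/
theorem convex_dualAttainment {ι : Type*} [DecidableEq ι] (s : Finset ι) :
    ∀ {C : Set E} {f : E → ℝ} {g : ι → E → ℝ}, ConvexOn ℝ C f →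
      (∀ i ∈ s, ConvexOn ℝ C (g i)) → (∃ x₀ ∈ C, ∀ i ∈ s, g i x₀ < 0) →
      ∀ p : ℝ, (∀ x ∈ C, (∀ i ∈ s, g i x ≤ 0) → p ≤ f x) →
        ∃ lam : ι → ℝ, (∀ i, 0 ≤ lam i) ∧ ∀ x ∈ C, p ≤ f x + ∑ i ∈ s, lam i * g i x := by
  induction s using Finset.induction_on with
  | empty =>
    intro C f g hf hg hS p hyp
    exact ⟨fun _ => 0, fun _ => le_rfl, fun x hx => by simpa using hyp x hx (by simp)⟩
  | insert a s has ih =>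
    intro C f g hf hg hS p hyp
    have hga : ConvexOn ℝ C (g a) := hg a (Finset.mem_insert_self _ _)
    set C' : Set E := {x | x ∈ C ∧ g a x ≤ 0} with hC'def
    have hC' : Convex ℝ C' := hga.convex_le 0
    have hsub : C' ⊆ C := fun x hx => hx.1
    obtain ⟨x₀, hx₀C, hx₀⟩ := hS
    have hx₀a : g a x₀ < 0 := hx₀ a (Finset.mem_insert_self _ _)
    obtain ⟨lam, hlam0, hlam⟩ := ih (hf.subset hsub hC')
      (fun i hi => (hg i (Finset.mem_insert_of_mem hi)).subset hsub hC')
      ⟨x₀, ⟨hx₀C, hx₀a.le⟩, fun i hi => hx₀ i (Finset.mem_insert_of_mem hi)⟩ p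
      (fun x hx h => hyp x hx.1 fun i hi => by
        rcases Finset.mem_insert.mp hi with rfl | hi
        · exact hx.2
        · exact h i hi)
    have hf' : ConvexOn ℝ C (fun x => f x + ∑ i ∈ s, lam i * g i x) :=
      hf.add (convexOn_finset_sum_mul hf.1 s (fun i hi => hg i (Finset.mem_insert_of_mem hi))
        lam hlam0)
    obtain ⟨μ, hμ0, hμ⟩ := convex_multiplier_one hf' hga ⟨x₀, hx₀C, hx₀a⟩
      (p := p) (fun x hx hax => hlam x ⟨hx, hax⟩)
    refine ⟨Function.update lam a μ, fun i => ?_, fun x hx => ?_⟩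
    · rcases eq_or_ne i a with rfl | hne
      · simp [hμ0]
      · simp [hne, hlam0 i]
    · rw [Finset.sum_insert has]
      have hrest : ∑ i ∈ s, Function.update lam a μ i * g i x = ∑ i ∈ s, lam i * g i x :=
        Finset.sum_congr rfl fun i hi => by
          rw [Function.update_apply, if_neg (ne_of_mem_of_not_mem hi has)]
      rw [hrest, Function.update_apply, if_pos rfl]
      have := hμ x hx
      linarith

/-- FACT-DISCHARGE: the vendored named fact (Borwein–Lewis 2000, Thm 4.3.7) follows — its
`FiniteDimensional` hypothesis is simply not needed. -/
theorem BorweinLewis2000_dualAttainment_holds :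
    Literature.Analysis.Convex.BorweinLewis2000_dualAttainment := by
  intro E _ _ _ m C f g hf hg hS p hyp
  classical
  obtain ⟨lam, hlam0, hlam⟩ := convex_dualAttainment (Finset.univ : Finset (Fin m))
    (C := C) (f := f) (g := g) hf (fun i _ => hg i)
    (by obtain ⟨x₀, hx₀, h⟩ := hS; exact ⟨x₀, hx₀, fun i _ => h i⟩) p
    (fun x hx h => hyp x hx fun i => h i (Finset.mem_univ i))
  exact ⟨lam, hlam0, hlam⟩

end ConvexEngine


/-! ## Autocorrelations -/

/-- `g ⋆ g̃` in the item's spelling (Mathlib primitives); definitionally `weilConv g (weilReflect g)`. -/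
noncomputable def autocorr (g : ℝ → ℂ) : ℝ → ℂ :=
  MeasureTheory.convolution g (fun u => (starRingEnd ℂ) (g (-u))) (ContinuousLinearMap.mul ℂ ℂ)
    MeasureTheory.MeasureSpace.volume

theorem autocorr_eq_weilConv (g : ℝ → ℂ) : autocorr g = weilConv g (weilReflect g) := rfl

theorem autocorr_apply (g : ℝ → ℂ) (x : ℝ) :
    autocorr g x = ∫ u : ℝ, g u * conj (g (u - x)) := by
  rw [autocorr, convolution_def]
  simp only [ContinuousLinearMap.mul_apply', neg_sub]

theorem isWeilTest_autocorr {g : ℝ → ℂ} (hg : IsWeilTest g) : IsWeilTest (autocorr g) :=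
  hg.weilConv hg.weilReflect

/-- `(c g) ⋆ (c g)̃ = c conj c · (g ⋆ g̃)` (no hypotheses). -/
theorem autocorr_const_mul (c : ℂ) (g : ℝ → ℂ) :
    autocorr (fun u => c * g u) = fun x => c * conj c * autocorr g x := by
  rw [autocorr_eq_weilConv, autocorr_eq_weilConv, weilReflect_const_mul, weilConv_const_mul_left,
    weilConv_const_mul_right]
  funext x
  ring

/-- `Re (g ⋆ g̃)(0) = ∫ ‖g‖²` (no hypotheses). -/
theorem autocorr_zero_re (g : ℝ → ℂ) : (autocorr g 0).re = ∫ u : ℝ, ‖g u‖ ^ 2 := by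
  rw [autocorr_apply]
  have : (fun u : ℝ => g u * conj (g (u - 0))) = fun u => (((‖g u‖ ^ 2 : ℝ)) : ℂ) := by
    funext u
    simp [Complex.mul_conj, Complex.normSq_eq_norm_sq]
  rw [this, integral_complex_ofReal, Complex.ofReal_re]

/-- Hermitian symmetry `(g ⋆ g̃)(-x) = conj ((g ⋆ g̃) x)` (no hypotheses). -/
theorem autocorr_neg (g : ℝ → ℂ) (x : ℝ) : autocorr g (-x) = conj (autocorr g x) := by
  rw [autocorr_apply, autocorr_apply, ← integral_conj]
  simp only [map_mul, Complex.conj_conj, sub_neg_eq_add]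
  have h : ∫ u : ℝ, conj (g (u + x)) * g (u + x - x) = ∫ u : ℝ, conj (g u) * g (u - x) :=
    integral_add_right_eq_self (μ := (volume : Measure ℝ)) (fun u : ℝ => conj (g u) * g (u - x)) x
  rw [← h]
  congr 1 with u
  rw [add_sub_cancel_right]
  ring

/-- Beyond the window the autocorrelation vanishes (closed endpoint included). -/
theorem autocorr_eq_zero_of_two_mul_le (a : ℝ) (g : ℝ → ℂ) (hg : Continuous g)
    (hsupp : tsupport g ⊆ Set.Icc (-a) a) (t : ℝ) (ht : 2 * a ≤ |t|) : autocorr g t = 0 := by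
  have hsup : Function.support g ⊆ Set.Ioo (-a) a := by
    have ho : IsOpen (Function.support g) := isOpen_ne_fun hg continuous_const
    have : Function.support g ⊆ interior (Set.Icc (-a) a) :=
      interior_maximal ((subset_tsupport g).trans hsupp) ho
    simpa [interior_Icc] using this
  have hzero : ∀ u, u ∉ Set.Ioo (-a) a → g u = 0 := fun u hu => by
    by_contra h
    exact hu (hsup h)
  rw [autocorr_apply]
  have hint : (fun u => g u * conj (g (u - t))) = fun _ => 0 := by
    funext u
    by_cases hu : u ∈ Set.Ioo (-a) a
    · by_cases hu' : u - t ∈ Set.Ioo (-a) a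
      · exfalso
        have h1 := hu.1; have h2 := hu.2; have h3 := hu'.1; have h4 := hu'.2
        have : |t| < 2 * a := by
          rw [abs_lt]; constructor <;> linarith
        linarith
      · rw [hzero _ hu', map_zero, mul_zero]
    · rw [hzero _ hu, zero_mul]
  rw [hint, integral_zero]

/-- The Slater bump: a smooth `g ≥ 0` on `[-a, a]`, positive on `(-a, a)`, has `Re (g ⋆ g̃)(t) > 0`
for `|t| < 2a`. -/
theorem slater_bump (a : ℝ) (ha : 0 < a) :
    ∃ g : ℝ → ℂ, (ContDiff ℝ ((⊤ : ℕ∞) : WithTop ℕ∞) g ∧ HasCompactSupport g) ∧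
      tsupport g ⊆ Set.Icc (-a) a ∧ ∀ t : ℝ, |t| < 2 * a → 0 < (autocorr g t).re := by
  let φ : ContDiffBump (0 : ℝ) := ⟨a / 2, a, by positivity, by linarith⟩
  refine ⟨fun x => ((φ x : ℝ) : ℂ), ⟨?_, ?_⟩, ?_, ?_⟩
  · exact Complex.ofRealCLM.contDiff.comp φ.contDiff
  · exact φ.hasCompactSupport.comp_left (g := fun r : ℝ => (r : ℂ)) Complex.ofReal_zero
  · have h1 : tsupport (fun x => ((φ x : ℝ) : ℂ)) ⊆ tsupport (φ : ℝ → ℝ) :=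
      closure_mono (Function.support_comp_subset (g := fun r : ℝ => (r : ℂ)) Complex.ofReal_zero _)
    refine h1.trans ?_
    rw [φ.tsupport_eq, Real.closedBall_eq_Icc]
    have hr : φ.rOut = a := rfl
    simp [hr]
  · intro t ht
    have hre : (autocorr (fun x => ((φ x : ℝ) : ℂ)) t) = ((∫ u : ℝ, φ u * φ (u - t) : ℝ) : ℂ) := by
      rw [autocorr_apply, ← integral_complex_ofReal]
      congr 1 with u
      simp only [Complex.conj_ofReal, Complex.ofReal_mul]
    rw [hre, Complex.ofReal_re]
    have hcont : Continuous fun u : ℝ => φ u * φ (u - t) :=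
      φ.continuous.mul (φ.continuous.comp (continuous_sub_right t))
    have hsupp : HasCompactSupport fun u : ℝ => φ u * φ (u - t) :=
      φ.hasCompactSupport.mul_right
    have hnonneg : 0 ≤ fun u : ℝ => φ u * φ (u - t) := fun u => mul_nonneg φ.nonneg φ.nonneg
    have hmid : (fun u : ℝ => φ u * φ (u - t)) (t / 2) ≠ 0 := by
      have hb1 : t / 2 ∈ Metric.ball (0 : ℝ) φ.rOut := by
        rw [Metric.mem_ball, Real.dist_eq, sub_zero, abs_div, abs_two]
        show |t| / 2 < a
        linarith
      have hb2 : t / 2 - t ∈ Metric.ball (0 : ℝ) φ.rOut := by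
        rw [Metric.mem_ball, Real.dist_eq, sub_zero, show t / 2 - t = -(t / 2) by ring, abs_neg,
          abs_div, abs_two]
        show |t| / 2 < a
        linarith
      exact (mul_pos (φ.pos_of_mem_ball hb1) (φ.pos_of_mem_ball hb2)).ne'
    exact hcont.integral_pos_of_hasCompactSupport_nonneg_nonzero hsupp hnonneg hmid

/-! ## The archimedean + polar functional -/

/-- The item's raw arch+polar expression IS `weilPolarTerm F + weilArchTerm F`. -/
theorem archPolar_eq (F : ℝ → ℂ) :
    (let M : ℂ → ℂ := fun s => ∫ u : ℝ, F u * Complex.exp ((s - 1 / 2) * u)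
     M 0 + M 1 + ((1 / (2 * Real.pi) : ℂ) * (∫ t : ℝ, M (1 / 2 + t * Complex.I) *
       ((Complex.digamma (1 / 4 + t / 2 * Complex.I)).re : ℂ)) - F 0 * (Real.log Real.pi : ℂ)))
      = weilPolarTerm F + weilArchTerm F := rfl

theorem archPolar_add {F₁ F₂ : ℝ → ℂ} (h₁ : IsWeilTest F₁) (h₂ : IsWeilTest F₂) :
    weilPolarTerm (F₁ + F₂) + weilArchTerm (F₁ + F₂) =
      (weilPolarTerm F₁ + weilArchTerm F₁) + (weilPolarTerm F₂ + weilArchTerm F₂) := by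
  have hM := weilMellin_add h₁.1.continuous h₁.2 h₂.1.continuous h₂.2
  have hP : weilPolarTerm (F₁ + F₂) = weilPolarTerm F₁ + weilPolarTerm F₂ := by
    simp only [weilPolarTerm, hM]
    ring
  have hA : weilArchTerm (F₁ + F₂) = weilArchTerm F₁ + weilArchTerm F₂ := by
    simp only [weilArchTerm, weilArchIntegral_add h₁ h₂, Pi.add_apply]
    ring
  rw [hP, hA]
  ring

/-- Homogeneity (no hypotheses). -/
theorem archPolar_const_mul (c : ℂ) (F : ℝ → ℂ) :
    weilPolarTerm (fun x => c * F x) + weilArchTerm (fun x => c * F x) =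
      c * (weilPolarTerm F + weilArchTerm F) := by
  have hM : ∀ s, weilMellin (fun x => c * F x) s = c * weilMellin F s := weilMellin_const_mul c F
  have hA : weilArchIntegral (fun x => c * F x) = c * weilArchIntegral F := by
    unfold weilArchIntegral
    rw [← integral_const_mul]
    congr 1 with t
    rw [hM]
    ring
  simp only [weilPolarTerm, weilArchTerm, hM, hA]
  ring

/-- Finite sums of test kernels are test kernels. -/
theorem isWeilTest_finset_sum {ι : Type*} (s : Finset ι) (G : ι → ℝ → ℂ)
    (hG : ∀ i ∈ s, IsWeilTest (G i)) : IsWeilTest (fun t => ∑ i ∈ s, G i t) := by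
  classical
  induction s using Finset.induction_on with
  | empty =>
    simp only [Finset.sum_empty]
    exact ⟨contDiff_const, HasCompactSupport.zero⟩
  | insert a s has ih =>
    have h := (hG a (Finset.mem_insert_self _ _)).add
      (ih fun i hi => hG i (Finset.mem_insert_of_mem hi))
    convert h using 1
    funext t
    simp [Finset.sum_insert has]

/-! ## The candidate proof of the crux, verbatim signature -/

theorem signConeDuality_candidate :
    ∀ a : ℝ, 0 < a → (∀ (k : ℕ) (g : Fin k → ℝ → ℂ), (∀ i, (ContDiff ℝ ((⊤ : ℕ∞) : WithTop ℕ∞) (g i) ∧ HasCompactSupport (g i)) ∧ tsupport (g i) ⊆ Set.Icc (-a) a) → let F : ℝ → ℂ := fun t => ∑ i, MeasureTheory.convolution (g i) (fun u => (starRingEnd ℂ) ((g i) (-u))) (ContinuousLinearMap.mul ℂ ℂ) MeasureTheory.MeasureSpace.volume t; (∀ n : ℕ, 2 ≤ n → 0 ≤ (F (Real.log n)).re) → let M : ℂ → ℂ := fun s => ∫ u : ℝ, F u * Complex.exp ((s - 1 / 2) * u); -(F 0).re ≤ (M 0 + M 1 + ((1 / (2 * Real.pi) : ℂ) * (∫ t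 : ℝ, M (1 / 2 + t * Complex.I) * ((Complex.digamma (1 / 4 + t / 2 * Complex.I)).re : ℂ)) - F 0 * (Real.log Real.pi : ℂ))).re) → ∃ c : ℕ → ℝ, (∀ n, 0 ≤ c n) ∧ c 1 = 0 ∧ ∀ g : ℝ → ℂ, (ContDiff ℝ ((⊤ : ℕ∞) : WithTop ℕ∞) g ∧ HasCompactSupport g) → tsupport g ⊆ Set.Icc (-a) a → let G : ℝ → ℂ := MeasureTheory.convolution g (fun u => (starRingEnd ℂ) (g (-u))) (ContinuousLinearMap.mul ℂ ℂ) MeasureTheory.MeasureSpace.volume; let M : ℂ → ℂ := fun s => ∫ u : ℝ, G u * Complex.exp ((s - 1 / 2) * u); -(∫ t, ‖g t‖ ^ 2) ≤ (M 0 + M 1 + ((1 / (2 * Real.pi) : ℂ) * (∫ t : ℝ, M (1 / 2 + t * Complex.I) * ((Complex.digamma (1 / 4 + t / 2 * Complex.I)).re : ℂ)) - G 0 * (Real.log Real.pi : ℂ)) - ∑' n : ℕ, ((c n : ℝ) : ℂ) / (Real.sqrt n : ℂ) * (G (Real.log n) + G (-Real.log n))).re := by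
  intro a ha hHyp
  classical
  -- admissible inputs, the Weil cone, the functionals, the active node set
  let adm : (ℝ → ℂ) → Prop := fun g =>
    (ContDiff ℝ ((⊤ : ℕ∞) : WithTop ℕ∞) g ∧ HasCompactSupport g) ∧ tsupport g ⊆ Set.Icc (-a) a
  let K : Set (ℝ → ℂ) :=
    {F | ∃ (k : ℕ) (g : Fin k → ℝ → ℂ), (∀ i, adm (g i)) ∧ F = fun t => ∑ i, autocorr (g i) t}
  let W : (ℝ → ℂ) → ℂ := fun F => weilPolarTerm F + weilArchTerm F
  let L₀ : (ℝ → ℂ) → ℝ := fun F => (W F).re + (F 0).re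
  let L : ℕ → (ℝ → ℂ) → ℝ := fun n F => (F (Real.log n)).re
  let ι : Finset ℕ := (Finset.range (⌈Real.exp (2 * a)⌉₊ + 1)).filter
    (fun n => 2 ≤ n ∧ (n : ℝ) < Real.exp (2 * a))
  have hι : ∀ n : ℕ, n ∈ ι ↔ 2 ≤ n ∧ (n : ℝ) < Real.exp (2 * a) := by
    intro n
    simp only [ι, Finset.mem_filter, Finset.mem_range]
    constructor
    · exact fun h => h.2
    · intro h
      refine ⟨?_, h⟩
      have h1 : (n : ℝ) < (⌈Real.exp (2 * a)⌉₊ : ℝ) := h.2.trans_le (Nat.le_ceil _)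
      have h2 : n < ⌈Real.exp (2 * a)⌉₊ := by exact_mod_cast h1
      omega
  -- (K1) members of K are test kernels
  have hKtest : ∀ F ∈ K, IsWeilTest F := by
    rintro F ⟨k, g, hg, rfl⟩
    exact isWeilTest_finset_sum (Finset.univ : Finset (Fin k)) (fun i => autocorr (g i))
      (fun i _ => isWeilTest_autocorr (hg i).1)
  -- (K2) K is closed under addition: concatenate the families
  have hKadd : ∀ ⦃F⦄, F ∈ K → ∀ ⦃F'⦄, F' ∈ K → F + F' ∈ K := by
    rintro F ⟨k, g, hg, rfl⟩ F' ⟨k', g', hg', rfl⟩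
    refine ⟨k + k', Fin.append g g', fun i => ?_, ?_⟩
    · refine Fin.addCases (fun i => ?_) (fun i => ?_) i
      · rw [Fin.append_left]; exact hg i
      · rw [Fin.append_right]; exact hg' i
    · funext t
      simp only [Pi.add_apply, Fin.sum_univ_add, Fin.append_left, Fin.append_right]
  -- (K3) K is closed under positive scalings: rescale the family by √t
  have hKsmul : ∀ ⦃t : ℝ⦄, 0 < t → ∀ ⦃F⦄, F ∈ K → t • F ∈ K := by
    rintro t ht F ⟨k, g, hg, rfl⟩
    set c : ℂ := ((Real.sqrt t : ℝ) : ℂ) with hc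
    have hcc : c * conj c = (t : ℂ) := by
      rw [hc, Complex.conj_ofReal, ← Complex.ofReal_mul, Real.mul_self_sqrt ht.le]
    refine ⟨k, fun i u => c * g i u, fun i => ?_, ?_⟩
    · obtain ⟨⟨h1, h2⟩, h3⟩ := hg i
      refine ⟨⟨contDiff_const.mul h1, h2.mul_left (f := fun _ : ℝ => c)⟩, ?_⟩
      exact (closure_mono (Function.support_mul_subset_right (fun _ : ℝ => c) (g i))).trans h3
    · funext x
      simp only [Pi.smul_apply, Finset.smul_sum, Complex.real_smul]
      refine Finset.sum_congr rfl fun i _ => ?_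
      rw [autocorr_const_mul c (g i)]
      simp only [hcc]
  -- (L1) cone-additivity of L₀: the analytic input, used once
  have h₀add : ∀ ⦃F⦄, F ∈ K → ∀ ⦃F'⦄, F' ∈ K → L₀ (F + F') = L₀ F + L₀ F' := by
    intro F hF F' hF'
    simp only [L₀, W]
    rw [archPolar_add (hKtest F hF) (hKtest F' hF')]
    simp only [Pi.add_apply, Complex.add_re]
    ring
  have h₀smul : ∀ ⦃t : ℝ⦄, 0 < t → ∀ ⦃F⦄, F ∈ K → L₀ (t • F) = t * L₀ F := by
    intro t ht F hF
    have hsm : t • F = fun x => (t : ℂ) * F x := by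
      funext x
      simp [Complex.real_smul]
    simp only [L₀, W]
    rw [hsm, archPolar_const_mul]
    simp only [Complex.re_ofReal_mul]
    ring
  have hLadd : ∀ n ∈ ι, ∀ ⦃F⦄, F ∈ K → ∀ ⦃F'⦄, F' ∈ K → L n (F + F') = L n F + L n F' := by
    intro n _ F _ F' _
    simp [L]
  have hLsmul : ∀ n ∈ ι, ∀ ⦃t : ℝ⦄, 0 < t → ∀ ⦃F⦄, F ∈ K → L n (t • F) = t * L n F := by
    intro n _ t _ F _
    simp [L]
  -- (S) the Slater point: one wide bump
  obtain ⟨g₀, hg₀, hg₀supp, hg₀pos⟩ := slater_bump a ha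
  have hF₀K : (fun t => ∑ i : Fin 1, autocorr g₀ t) ∈ K :=
    ⟨1, fun _ => g₀, fun _ => ⟨hg₀, hg₀supp⟩, rfl⟩
  have hS : ∃ x₀ ∈ K, ∀ n ∈ ι, 0 < L n x₀ := by
    refine ⟨_, hF₀K, fun n hn => ?_⟩
    obtain ⟨h2, hlt⟩ := (hι n).1 hn
    simp only [L, Fin.sum_univ_one]
    apply hg₀pos
    have hn0 : (0 : ℝ) < n := by exact_mod_cast (by omega : 0 < n)
    have hlog : Real.log n < 2 * a := by
      rw [Real.log_lt_iff_lt_exp hn0]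
      exact hlt
    have hlog0 : 0 ≤ Real.log n := Real.log_nonneg (by exact_mod_cast (by omega : 1 ≤ n))
    rw [abs_of_nonneg hlog0]
    exact hlog
  -- (H) the item's hypothesis, transported to the finite node set
  have hyp : ∀ F ∈ K, (∀ n ∈ ι, 0 ≤ L n F) → 0 ≤ L₀ F := by
    rintro F ⟨k, g, hg, rfl⟩ hnodes
    have hall : ∀ n : ℕ, 2 ≤ n → 0 ≤ ((fun t => ∑ i, autocorr (g i) t) (Real.log n)).re := by
      intro n hn
      by_cases hmem : n ∈ ι
      · exact hnodes n hmem
      · have hge : Real.exp (2 * a) ≤ n := by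
          by_contra hlt
          push Not at hlt
          exact hmem ((hι n).2 ⟨hn, hlt⟩)
        have hn0 : (0 : ℝ) < n := by exact_mod_cast (by omega : 0 < n)
        have hlog : 2 * a ≤ |Real.log n| := by
          rw [abs_of_nonneg (Real.log_nonneg (by exact_mod_cast (by omega : 1 ≤ n)))]
          rw [Real.le_log_iff_exp_le hn0]
          exact hge
        have hz : (fun t => ∑ i, autocorr (g i) t) (Real.log n) = 0 := by
          simp only
          exact Finset.sum_eq_zero fun i _ =>
            autocorr_eq_zero_of_two_mul_le a (g i) (hg i).1.1.continuous (hg i).2 _ hlog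
        rw [hz]
        simp
    have h := hHyp k g hg hall
    have h' : -((fun t => ∑ i, autocorr (g i) t) 0).re ≤
        (W (fun t => ∑ i, autocorr (g i) t)).re := h
    simp only [L₀]
    simp only at h'
    linarith
  -- (E) constraint elimination
  obtain ⟨lam, hlam0, hlam⟩ := cone_multipliers ι hKadd hKsmul h₀add h₀smul hLadd hLsmul hS hyp
  -- (C) the fake von Mangoldt weight
  have h1 : (1 : ℕ) ∉ ι := fun h => by
    have := ((hι 1).1 h).1
    omega
  refine ⟨fun n => if n ∈ ι then lam n * Real.sqrt n / 2 else 0, fun n => ?_, by simp [h1], ?_⟩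
  · by_cases hn : n ∈ ι
    · simp only [hn, if_true]
      exact div_nonneg (mul_nonneg (hlam0 n) (Real.sqrt_nonneg _)) zero_le_two
    · simp [hn]
  · intro g hg hsupp
    have hGK : (fun t => ∑ i : Fin 1, autocorr g t) ∈ K :=
      ⟨1, fun _ => g, fun _ => ⟨hg, hsupp⟩, rfl⟩
    have hmain := hlam _ hGK
    have hG1 : (fun t => ∑ i : Fin 1, autocorr g t) = autocorr g := by
      funext t
      simp
    rw [hG1] at hmain
    simp only [L, L₀, W] at hmain
    have hterm : ∀ n ∈ ι,
        ((((if n ∈ ι then lam n * Real.sqrt n / 2 else 0 : ℝ)) : ℂ) / (Real.sqrt n : ℂ) *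
            (autocorr g (Real.log n) + autocorr g (-Real.log n))).re =
          lam n * (autocorr g (Real.log n)).re := by
      intro n hn
      simp only [hn, if_true]
      have hn2 : 2 ≤ n := ((hι n).1 hn).1
      have hsq : 0 < Real.sqrt n := Real.sqrt_pos.2 (by exact_mod_cast (by omega : 0 < n))
      rw [autocorr_neg, Complex.add_conj, ← Complex.ofReal_div, ← Complex.ofReal_mul,
        Complex.ofReal_re]
      field_simp
    have key : -(∫ t, ‖g t‖ ^ 2) ≤ (weilPolarTerm (autocorr g) + weilArchTerm (autocorr g) -
        ∑' n : ℕ, ((((if n ∈ ι then lam n * Real.sqrt n / 2 else 0 : ℝ)) : ℂ) /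
          (Real.sqrt n : ℂ) * (autocorr g (Real.log n) + autocorr g (-Real.log n)))).re := by
      rw [tsum_eq_sum (s := ι) (fun n hn => by simp [hn]), Complex.sub_re, Complex.re_sum,
        Finset.sum_congr rfl hterm, ← autocorr_zero_re g]
      linarith
    exact key


/-- The route item, BY NAME. -/
theorem signConeDuality_closes :
    Summit.RiemannHypothesis.RiemannHypothesis.Theses.SignCone.SignConeDuality :=
  signConeDuality_candidate


end Summit.RiemannHypothesis.RiemannHypothesis.Cruxes.SignConeDuality.PeelOneNode
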